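import Literature.NumberTheory.EllipticCurves.QuadraticTwistTateFormProofs
import Literature.NumberTheory.EllipticCurves.LocalReductionKrausTwo
import Literature.NumberTheory.EllipticCurves.HasseWeilAbelianConductor
import Literature.NumberTheory.EllipticCurves.RootNumberSmulProofs
import Literature.NumberTheory.DiophantineGeometry.TateAlgorithmIstarCharTwoProofs
import Literature.NumberTheory.DiophantineGeometry.MinimalDiscriminantNormProofs
import HarnessLib

/-!
# Quadratic twists of the Tate normal form at `2`: Kodaira types `I*_{ν+4}`, `I*_{ν+8}` and the
# conductor exponents `f₂ = 4, 6` of a potentially multiplicative elliptic curve over `ℚ₂`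

`Proofs` file (theorems only, no definitions, no named facts) in topic
`NumberTheory/EllipticCurves`, sequel of `QuadraticTwistTateFormProofs`, landed by the seat of
bsd.S15 (`Literature.NumberTheory.EllipticCurves.conductorNorm_eq_artinConductorNat`) as the
**discriminant side of Ogg's formula** (Silverman, *ATAEC*, IV.11.1) **at the place `2` of `ℚ`
for the curves with `ord₂(j) < 0`** (the potentially multiplicative ones).

Let `E/ℚ` be elliptic with `ord₂(j) = -ν < 0` and let `T = tateFormOfJ j`
(`y² + xy = x³ - 36x/(j - 1728) - 1/(j - 1728)`, multiplicative at `2`).  Over `ℚ`, `E` is a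
quadratic twist `T^{(d)}` of `T` (`exists_variableChange_tateFormOfJ_eq_quadraticTwist` with
`quadraticTwist_quadraticTwist`), and `d ∈ ℤ` may be taken with `4 ∤ d`.  We compute at `v = 2`:

* `d ≡ 1 (mod 4)`: `T^{(d)} ≅ y² + xy = x³ + ((d-1)/4)x² + d²a₄x + d³a₆`, integral with unit
  `c₄`, so `E` has **multiplicative** reduction at `2` (`hasMultiplicativeReductionAt_two_of_…`);
* `d ≡ 3 (mod 4)`: the model `y² + 2xy = x³ + (d-1)x² + 16d²a₄x + 64d³a₆` is integral and
  **minimal** (Kraus's necessary condition, `kraus_two_of_integral`, fails for the only possible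
  descent `u = 2w`), of **Kodaira type `I*_{ν+4}`** (`kodairaSymbolOfMinimal_familyA` of
  `TateAlgorithmIstarCharTwoProofs`, `N = ν + 6`) with `ord₂ Δ_min = ν + 12`, hence
  **`f₂ = 4`, `δ₂ = 2`**;
* `d ≡ 2 (mod 4)`: the model `y² = x³ + dx² + 16d²a₄x + 64d³a₆` is integral and minimal, of
  **type `I*_{ν+8}`** (`kodairaSymbolOfMinimal_familyB`, `N = ν + 9`) with `ord₂ Δ_min = ν + 18`,
  hence **`f₂ = 6`, `δ₂ = 4`**.

These are the values `f = 2f(χ_d)` (conductor exponents `2`, `3` of `ℚ₂(√d)`) predicted by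
Ogg's formula from the Galois side `Sw = 2 Sw(χ_d)`; the Galois side is in
`SqrtUpperRamificationProofs`, the assembly in `OggFormulaPotMultTwoProofs`.

## References

* J. H. Silverman, *Advanced Topics in the Arithmetic of Elliptic Curves*, GTM 151 (1994),
  IV.9.4 (Tate's algorithm), Table 4.1, IV.11.1 (Ogg's formula), V.5 Lemma 5.1 (Tate form).
  [SilvermanATAEC1994]
* A. Kraus, *Quelques remarques à propos des invariants c₄, c₆ et Δ d'une courbe elliptique*,
  Acta Arith. 54 (1989), Prop. 2. [Kraus1989]
* J. H. Silverman, *The Arithmetic of Elliptic Curves*, 2nd ed. (2009), VII.1, X.5 Cor. 5.4.1.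
  [SilvermanAEC2009]
-/

noncomputable section

open scoped Classical NumberField
open IsDedekindDomain Rat.HeightOneSpectrum Literature.NumberTheory.DiophantineGeometry
  Literature.NumberTheory.DiophantineGeometry.TateAlgorithm Literature.NumberTheory.EllipticCurves
  Literature.NumberTheory.GaloisRepresentations

namespace WeierstrassCurve

/-! ### `O_v`-elements of prescribed valuation -/

section Completion

variable {A : Type*} [CommRing A] [IsDedekindDomain A] {K : Type*} [Field K] [Algebra A K]
  [IsFractionRing A K] (v : HeightOneSpectrum A)

/-- `|x|_v ≤ exp(-n)` for `x ∈ O_v` gives `ϖⁿ ∣ x` (`ϖ` the chosen uniformiser of `O_v`).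
[folklore] -/
theorem uniformizer_pow_dvd_of_valued_le {x : v.adicCompletionIntegers K} {n : ℕ}
    (h : Valued.v (x : v.adicCompletion K) ≤ WithZero.exp (-(n : ℤ))) :
    uniformizer (v.adicCompletionIntegers K) ^ n ∣ x := by
  by_cases hx : x = 0
  · rw [hx]; exact dvd_zero _
  obtain ⟨N, hN, hvx⟩ := HeightOneSpectrum.exists_addVal_adicCompletionIntegers_eq K v x hx
  rw [hvx, WithZero.exp_le_exp] at h
  have hnN : n ≤ N := by omega
  rw [pow_dvd_iff_le_addVal, hN]
  exact_mod_cast hnN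

/-- `|x|_v = exp(-n)` for `x ∈ O_v` gives `x = ϖⁿ u` with `u` a unit. [folklore] -/
theorem exists_isUnit_eq_uniformizer_pow_mul_of_valued_eq {x : v.adicCompletionIntegers K} {n : ℕ}
    (h : Valued.v (x : v.adicCompletion K) = WithZero.exp (-(n : ℤ))) :
    ∃ u : v.adicCompletionIntegers K, IsUnit u ∧
      x = uniformizer (v.adicCompletionIntegers K) ^ n * u := by
  have hϖ : Irreducible (uniformizer (v.adicCompletionIntegers K)) := irreducible_uniformizer
  have hx : x ≠ 0 := by
    intro hx; rw [hx] at h; simp only [ZeroMemClass.coe_zero, map_zero] at h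
    exact WithZero.coe_ne_zero h.symm
  obtain ⟨m, u, hxu⟩ := IsDiscreteValuationRing.eq_unit_mul_pow_irreducible hx hϖ
  have hm : IsDiscreteValuationRing.addVal (v.adicCompletionIntegers K) x = m :=
    IsDiscreteValuationRing.addVal_def x u hϖ m hxu
  obtain ⟨N, hN, hvx⟩ := HeightOneSpectrum.exists_addVal_adicCompletionIntegers_eq K v x hx
  rw [hvx] at h
  have hNn : N = n := by
    have := WithZero.exp_injective h
    omega
  rw [hm] at hN
  have hmN : m = N := by exact_mod_cast hN
  refine ⟨u, u.isUnit, ?_⟩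
  rw [hxu, hmN, hNn, mul_comm]

/-- `|x|_v = exp(-n)` for `x ∈ O_v` gives `ord x = n`. [folklore] -/
theorem addVal_toNat_eq_of_valued_eq {x : v.adicCompletionIntegers K} {n : ℕ}
    (h : Valued.v (x : v.adicCompletion K) = WithZero.exp (-(n : ℤ))) :
    (IsDiscreteValuationRing.addVal (v.adicCompletionIntegers K) x).toNat = n := by
  have hx : x ≠ 0 := by
    intro hx; rw [hx] at h; simp only [ZeroMemClass.coe_zero, map_zero] at h
    exact WithZero.coe_ne_zero h.symm
  obtain ⟨N, hN, hvx⟩ := HeightOneSpectrum.exists_addVal_adicCompletionIntegers_eq K v x hx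
  rw [hvx] at h
  have hNn : N = n := by
    have := WithZero.exp_injective h
    omega
  rw [hN, hNn]
  rfl

end Completion

/-! ### The place `2` of `ℚ`: `2 = ϖ ε` -/

section TwoAdic

variable (v : HeightOneSpectrum (𝓞 ℚ))

/-- At the place of `ℚ` above `2`, `2` is a uniformiser of `O_v = ℤ₂`: `2 = ϖ ε` with `ε` a unit
(`|2|_v = exp(-1)`). [folklore] -/
theorem exists_isUnit_two_eq_uniformizer_mul (hv : natGenerator v = 2) :
    ∃ ε : v.adicCompletionIntegers ℚ, IsUnit ε ∧
      (2 : v.adicCompletionIntegers ℚ) = uniformizer (v.adicCompletionIntegers ℚ) * ε := by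
  have h2 : Valued.v (((2 : v.adicCompletionIntegers ℚ) : v.adicCompletionIntegers ℚ) :
      v.adicCompletion ℚ) = WithZero.exp (-((1 : ℕ) : ℤ)) := by
    push_cast
    exact valued_two v hv
  obtain ⟨u, hu, h⟩ := exists_isUnit_eq_uniformizer_pow_mul_of_valued_eq v h2
  exact ⟨u, hu, by rw [h, pow_one]⟩


/-- **Minimality at `2` from the failure of Kraus's conditions for the descended invariants.**
Let `X` be a `2`-adically integral Weierstrass equation over `ℚ₂` with `|c₄(X)|₂ > 2⁻⁸`.  If for
no `2`-adic unit `w` the pair `(c₄(X)/(16w⁴), c₆(X)/(64w⁶))` satisfies Kraus's necessary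
condition (`kraus_two_of_integral`), then `X` is minimal: an integral `C • X` with `|u| < 1` has
`|c₄(C • X)| = |u|⁻⁴|c₄(X)| ≤ 1`, forcing `u = 2w` with `w` a unit, and then
`c₄(C • X) = c₄(X)/(16w⁴)`, `c₆(C • X) = c₆(X)/(64w⁶)` would satisfy Kraus's condition.
Kraus 1989, Prop. 2; Silverman *AEC* VII.1. [cite: Kraus1989, Prop. 2]
[cite: SilvermanAEC2009, VII.1 (minimal equations) and III.1 Table 3.1] -/
theorem isMinimal_of_kraus_fails (hv : natGenerator v = 2) (Y : WeierstrassCurve (v.adicCompletion ℚ))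
    [Y.IsIntegral (v.adicCompletionIntegers ℚ)]
    (hc₄ : WithZero.exp (-8 : ℤ) < Valued.v Y.c₄)
    (hK : ∀ w : v.adicCompletion ℚ, Valued.v w = 1 →
      ¬ ((Valued.v (Y.c₄ / (16 * w ^ 4)) ≤ WithZero.exp (-4 : ℤ) ∧
          (Valued.v (Y.c₆ / (64 * w ^ 6)) ≤ WithZero.exp (-5 : ℤ) ∨
            Valued.v (Y.c₆ / (64 * w ^ 6) - 8) ≤ WithZero.exp (-5 : ℤ))) ∨
        Valued.v (Y.c₆ / (64 * w ^ 6) + 1) ≤ WithZero.exp (-2 : ℤ))) :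
    Y.IsMinimal (v.adicCompletionIntegers ℚ) := by
  have V2 := valued_two v hv
  have h20 : (2 : v.adicCompletion ℚ) ≠ 0 := by
    intro h; rw [h, Valuation.map_zero] at V2; exact WithZero.coe_ne_zero V2.symm
  have hV1 : ∀ x : v.adicCompletion ℚ, x ∈ (algebraMap (v.adicCompletionIntegers ℚ) (v.adicCompletion ℚ)).range → Valued.v x ≤ 1 :=
    fun x hx ↦ (valued_le_one_iff_mem_range_adicCompletionIntegers v x).mpr hx
  rw [isMinimal_iff_of_le_one_iff (valued_le_one_iff_mem_range_adicCompletionIntegers v)]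
  refine ⟨inferInstance, fun C hC ↦ ?_⟩
  haveI := hC
  rw [variableChange_Δ, Valuation.map_mul, Valuation.map_pow]
  set U : WithZero (Multiplicative ℤ) := Valued.v (↑C.u⁻¹ : v.adicCompletion ℚ) with hU
  by_cases hU1 : U ≤ 1
  · exact mul_le_of_le_one_left zero_le (pow_le_one₀ zero_le hU1)
  exfalso
  replace hU1 : 1 < U := not_le.mp hU1
  have hU0 : U ≠ 0 := (Valuation.ne_zero_iff _).mpr (Units.ne_zero _)
  -- integrality of `c₄(C • Y)` forces `ord(u) = 1`
  have hc : Valued.v (C • Y).c₄ ≤ 1 := hV1 _ ⟨_, integralModel_c₄_eq (v.adicCompletionIntegers ℚ) (C • Y)⟩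
  rw [variableChange_c₄, Valuation.map_mul, Valuation.map_pow] at hc
  have hc0 : Valued.v Y.c₄ ≠ 0 := (WithZero.exp_pos.trans hc₄).ne'
  have hUe : U = WithZero.exp (1 : ℤ) := by
    have hl1 : 0 < WithZero.log U := WithZero.lt_log_of_exp_lt (by rwa [WithZero.exp_zero])
    have h1 : -8 < WithZero.log (Valued.v Y.c₄) := WithZero.lt_log_of_exp_lt hc₄
    have h2 : 4 • WithZero.log U + WithZero.log (Valued.v Y.c₄) ≤ 0 := by
      rw [← WithZero.log_pow, ← WithZero.log_mul (pow_ne_zero _ hU0) hc0, ← WithZero.log_one]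
      exact (WithZero.log_le_log (mul_ne_zero (pow_ne_zero _ hU0) hc0) one_ne_zero).mpr hc
    have hlog : WithZero.log U = 1 := by
      simp only [nsmul_eq_mul, Nat.cast_ofNat] at h2
      omega
    rw [← WithZero.exp_log hU0, hlog]
  -- the unit `w = u / 2`
  set w : v.adicCompletion ℚ := (C.u : v.adicCompletion ℚ) / 2 with hw
  have hw1 : Valued.v w = 1 := by
    have hu : Valued.v ((C.u : v.adicCompletion ℚ)) = WithZero.exp (-1 : ℤ) := by
      have h1 : Valued.v ((C.u : v.adicCompletion ℚ)) * U = 1 := by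
        rw [hU, ← Valuation.map_mul, Units.mul_inv, Valuation.map_one]
      rw [hUe] at h1
      calc Valued.v ((C.u : v.adicCompletion ℚ)) = Valued.v ((C.u : v.adicCompletion ℚ)) * WithZero.exp (1 : ℤ) * WithZero.exp (-1 : ℤ) := by
            rw [mul_assoc, withZero_exp_mul_exp]; simp
        _ = WithZero.exp (-1 : ℤ) := by rw [h1, one_mul]
    rw [hw, map_div₀, hu, V2, div_self (WithZero.coe_ne_zero)]
  have hu2w : (C.u : v.adicCompletion ℚ) = 2 * w := by rw [hw]; field_simp
  have hw0 : w ≠ 0 := by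
    intro h; rw [h, Valuation.map_zero] at hw1; exact zero_ne_one hw1
  have hinv4 : (↑C.u⁻¹ : v.adicCompletion ℚ) ^ 4 * Y.c₄ = Y.c₄ / (16 * w ^ 4) := by
    rw [Units.val_inv_eq_inv_val, hu2w, inv_pow, mul_pow, mul_comm, div_eq_mul_inv]
    norm_num
  have hinv6 : (↑C.u⁻¹ : v.adicCompletion ℚ) ^ 6 * Y.c₆ = Y.c₆ / (64 * w ^ 6) := by
    rw [Units.val_inv_eq_inv_val, hu2w, inv_pow, mul_pow, mul_comm, div_eq_mul_inv]
    norm_num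
  -- Kraus for the integral `C • Y`
  obtain ⟨i1, i2, i3, i4, i6⟩ := (isIntegral_iff_forall_mem_range (C • Y)).mp hC
  have hKr := kraus_two_of_integral v hv (C • Y) (hV1 _ i1) (hV1 _ i2) (hV1 _ i3) (hV1 _ i4)
    (hV1 _ i6)
  rw [variableChange_c₄, variableChange_c₆, hinv4, hinv6] at hKr
  exact hK w hw1 hKr

end TwoAdic

/-! ### The Tate normal form at a place with `ord_v(j) = -ν < 0` -/

section TateData

variable (v : HeightOneSpectrum (𝓞 ℚ))

/-- `ord_v(j) = -ν` with `ν ≥ 1` when `ord_v(j) < 0`. [folklore] -/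
theorem exists_valuation_j_eq_exp (W : WeierstrassCurve ℚ) [W.IsElliptic]
    (hj : 1 < v.valuation ℚ W.j) :
    ∃ ν : ℕ, 1 ≤ ν ∧ v.valuation ℚ W.j = WithZero.exp (ν : ℤ) := by
  have h0 : v.valuation ℚ W.j ≠ 0 := (lt_trans zero_lt_one hj).ne'
  have hlog : 0 < WithZero.log (v.valuation ℚ W.j) :=
    WithZero.lt_log_of_exp_lt (by rwa [WithZero.exp_zero])
  refine ⟨(WithZero.log (v.valuation ℚ W.j)).toNat, by omega, ?_⟩
  rw [Int.toNat_of_nonneg hlog.le, WithZero.exp_log h0]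

/-- `c₆ + 1 = 72a₄ - 864a₆` for the Tate normal form `y² + xy = x³ + a₄x + a₆`
(`b₂ = 1`, `b₄ = 2a₄`, `b₆ = 4a₆`). [folklore] -/
theorem tateFormOfJ_c₆_add_one (j : ℚ) :
    (tateFormOfJ j).c₆ + 1 = 72 * (tateFormOfJ j).a₄ - 864 * (tateFormOfJ j).a₆ := by
  simp only [WeierstrassCurve.c₆, WeierstrassCurve.b₂, WeierstrassCurve.b₄, WeierstrassCurve.b₆,
    tateFormOfJ_a₁, tateFormOfJ_a₂, tateFormOfJ_a₃]
  ring

/-- Valuations of the Tate normal form at a place `v ∋ 2` with `ord_v(j) = -ν`: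
`|a₄| = exp(-(ν+2))`, `|a₆| = exp(-ν)`, `|Δ| = exp(-ν)`, `|c₆ + 1| ≤ exp(-(ν+5))`
(`a₄ = -36/(j-1728)`, `a₆ = -1/(j-1728)`, `Δ = j²/(j-1728)³`, `c₆ + 1 = 72a₄ - 864a₆`,
`ord_v(j - 1728) = ord_v(j)`).  Silverman *ATAEC* V.5 Lemma 5.1.
[cite: SilvermanATAEC1994, V.5 Lemma 5.1] -/
theorem valuation_tateFormOfJ_of_natGenerator_eq_two (W : WeierstrassCurve ℚ) [W.IsElliptic]
    (hv : natGenerator v = 2) (hj : 1 < v.valuation ℚ W.j) {ν : ℕ} (hν : v.valuation ℚ W.j = WithZero.exp (ν : ℤ)) :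
    v.valuation ℚ (tateFormOfJ W.j).a₄ = WithZero.exp (-((ν + 2 : ℕ) : ℤ)) ∧
      v.valuation ℚ (tateFormOfJ W.j).a₆ = WithZero.exp (-(ν : ℤ)) ∧
      v.valuation ℚ (tateFormOfJ W.j).Δ = WithZero.exp (-(ν : ℤ)) ∧
      v.valuation ℚ ((tateFormOfJ W.j).c₆ + 1) ≤ WithZero.exp (-((ν + 5 : ℕ) : ℤ)) := by
  obtain ⟨hj0, hj1728, hsub⟩ := W.j_ne_and_valuation_j_sub_eq_of_one_lt_valuation_j v hj
  set V := v.valuation ℚ with hV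
  have h36 : V (36 : ℚ) = WithZero.exp (-2 : ℤ) := by
    have h4 : V (4 : ℚ) = WithZero.exp (-2 : ℤ) := by
      have := Rat.valuation_natGenerator v
      rw [hv, Nat.cast_ofNat, ← hV] at this
      rw [show (4 : ℚ) = 2 * 2 by norm_num, map_mul, this, withZero_exp_mul_exp]; norm_num
    have h9 : V (9 : ℚ) = 1 := by
      have := Rat.valuation_intCast_eq_one v (n := 9) (by rw [hv]; decide)
      rw [← hV] at this; exact_mod_cast this
    rw [show (36 : ℚ) = 4 * 9 by norm_num, map_mul, h4, h9, mul_one]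
  have h72 : V (72 : ℚ) = WithZero.exp (-3 : ℤ) := by
    have h8 : V (8 : ℚ) = WithZero.exp (-3 : ℤ) := by
      have := Rat.valuation_intCast_le v (n := 8) (e := 3) (by rw [hv]; decide)
      have h' := Rat.valuation_intCast_eq_one v (n := 9) (by rw [hv]; decide)
      have := Rat.valuation_natGenerator v
      rw [hv, Nat.cast_ofNat, ← hV] at this
      rw [show (8 : ℚ) = 2 * 2 * 2 by norm_num, map_mul, map_mul, this, withZero_exp_mul_exp,
        withZero_exp_mul_exp]; norm_num
    have h9 : V (9 : ℚ) = 1 := by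
      have := Rat.valuation_intCast_eq_one v (n := 9) (by rw [hv]; decide)
      rw [← hV] at this; exact_mod_cast this
    rw [show (72 : ℚ) = 8 * 9 by norm_num, map_mul, h8, h9, mul_one]
  have h864 : V (864 : ℚ) = WithZero.exp (-5 : ℤ) := by
    have h2 : V (2 : ℚ) = WithZero.exp (-1 : ℤ) := by
      have := Rat.valuation_natGenerator v
      rwa [hv, Nat.cast_ofNat, ← hV] at this
    have h27 : V (27 : ℚ) = 1 := by
      have := Rat.valuation_intCast_eq_one v (n := 27) (by rw [hv]; decide)
      rw [← hV] at this; exact_mod_cast this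
    rw [show (864 : ℚ) = 2 ^ 5 * 27 by norm_num, map_mul, map_pow, h2, h27, mul_one,
      ← WithZero.exp_nsmul]; norm_num
  have hexpν : (WithZero.exp (ν : ℤ))⁻¹ = WithZero.exp (-(ν : ℤ)) := by
    rw [← WithZero.exp_neg]
  have ha₄ : V (tateFormOfJ W.j).a₄ = WithZero.exp (-((ν + 2 : ℕ) : ℤ)) := by
    rw [tateFormOfJ_a₄, map_div₀, Valuation.map_neg, h36, hsub, hν, div_eq_mul_inv, hexpν,
      withZero_exp_mul_exp]
    congr 1; push_cast; ring
  have ha₆ : V (tateFormOfJ W.j).a₆ = WithZero.exp (-(ν : ℤ)) := by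
    rw [tateFormOfJ_a₆, map_div₀, Valuation.map_neg, map_one, hsub, hν, one_div, hexpν]
  refine ⟨ha₄, ha₆, ?_, ?_⟩
  · rw [tateFormOfJ_Δ hj1728, map_div₀, map_pow, map_pow, hsub, hν, ← WithZero.exp_nsmul,
      ← WithZero.exp_nsmul, div_eq_mul_inv, ← WithZero.exp_neg, withZero_exp_mul_exp]
    congr 1; simp; ring
  · rw [tateFormOfJ_c₆_add_one]
    refine le_trans (Valuation.map_sub _ _ _) (max_le ?_ ?_)
    · rw [map_mul, h72, ha₄, withZero_exp_mul_exp, WithZero.exp_le_exp]; push_cast; omega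
    · rw [map_mul, h864, ha₆, withZero_exp_mul_exp, WithZero.exp_le_exp]; push_cast; omega

end TateData

/-! ### The model `y² + 2xy = x³ + (d-1)x² + 16d²a₄x + 64d³a₆` of `T^{(d)}` -/

section Models

/-- `(½; 0, ½, 0) • T^{(d)} = y² + 2xy = x³ + (d-1)x² + 16d²a₄x + 64d³a₆` for the Tate normal
form `T = tateFormOfJ j` (`b₂ = 1`, `b₄ = 2a₄`, `b₆ = 4a₆`; `T^{(d)} = (0, d/4, 0, d²a₄, d³a₆)`).
Silverman *AEC* III.1 Table 3.1. [cite: SilvermanAEC2009, III.1 Table 3.1] -/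
theorem smul_quadraticTwist_tateFormOfJ_eq_modelA (j d : ℚ) :
    (⟨⟨2⁻¹, 2, by norm_num, by norm_num⟩, 0, 2⁻¹, 0⟩ : VariableChange ℚ) •
        (tateFormOfJ j).quadraticTwist d =
      ⟨2, d - 1, 0, 16 * d ^ 2 * (tateFormOfJ j).a₄, 64 * d ^ 3 * (tateFormOfJ j).a₆⟩ := by
  ext
  · rw [variableChange_a₁]; simp
  · rw [variableChange_a₂]
    simp only [quadraticTwist_a₁, quadraticTwist_a₂, WeierstrassCurve.b₂, tateFormOfJ_a₁,
      tateFormOfJ_a₂, Units.val_inv_eq_inv_val, inv_inv]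
    ring
  · rw [variableChange_a₃]; simp
  · rw [variableChange_a₄]
    simp only [quadraticTwist_a₁, quadraticTwist_a₂, quadraticTwist_a₃, quadraticTwist_a₄,
      WeierstrassCurve.b₂, WeierstrassCurve.b₄, tateFormOfJ_a₁, tateFormOfJ_a₂, tateFormOfJ_a₃,
      Units.val_inv_eq_inv_val, inv_inv]
    ring
  · rw [variableChange_a₆]
    simp only [quadraticTwist_a₁, quadraticTwist_a₂, quadraticTwist_a₃, quadraticTwist_a₄,
      quadraticTwist_a₆, WeierstrassCurve.b₂, WeierstrassCurve.b₄, WeierstrassCurve.b₆,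
      tateFormOfJ_a₁, tateFormOfJ_a₂, tateFormOfJ_a₃, Units.val_inv_eq_inv_val, inv_inv]
    ring

/-- `(½; 0, 0, 0) • T^{(d)} = y² = x³ + dx² + 16d²a₄x + 64d³a₆`. Silverman *AEC* III.1
Table 3.1. [cite: SilvermanAEC2009, III.1 Table 3.1] -/
theorem smul_quadraticTwist_tateFormOfJ_eq_modelB (j d : ℚ) :
    (⟨⟨2⁻¹, 2, by norm_num, by norm_num⟩, 0, 0, 0⟩ : VariableChange ℚ) •
        (tateFormOfJ j).quadraticTwist d =
      ⟨0, d, 0, 16 * d ^ 2 * (tateFormOfJ j).a₄, 64 * d ^ 3 * (tateFormOfJ j).a₆⟩ := by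
  ext
  · rw [variableChange_a₁]; simp
  · rw [variableChange_a₂]
    simp only [quadraticTwist_a₁, quadraticTwist_a₂, WeierstrassCurve.b₂, tateFormOfJ_a₁,
      tateFormOfJ_a₂, Units.val_inv_eq_inv_val, inv_inv]
    ring
  · rw [variableChange_a₃]; simp
  · rw [variableChange_a₄]
    simp only [quadraticTwist_a₁, quadraticTwist_a₂, quadraticTwist_a₃, quadraticTwist_a₄,
      WeierstrassCurve.b₂, WeierstrassCurve.b₄, tateFormOfJ_a₁, tateFormOfJ_a₂, tateFormOfJ_a₃,
      Units.val_inv_eq_inv_val, inv_inv]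
    ring
  · rw [variableChange_a₆]
    simp only [quadraticTwist_a₁, quadraticTwist_a₂, quadraticTwist_a₃, quadraticTwist_a₄,
      quadraticTwist_a₆, WeierstrassCurve.b₂, WeierstrassCurve.b₄, WeierstrassCurve.b₆,
      tateFormOfJ_a₁, tateFormOfJ_a₂, tateFormOfJ_a₃, Units.val_inv_eq_inv_val, inv_inv]
    ring

/-- `(1; 0, ½, 0) • T^{(d)} = y² + xy = x³ + ((d-1)/4)x² + d²a₄x + d³a₆`. Silverman *AEC* III.1
Table 3.1. [cite: SilvermanAEC2009, III.1 Table 3.1] -/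
theorem smul_quadraticTwist_tateFormOfJ_eq_modelOne (j d : ℚ) :
    (⟨1, 0, 2⁻¹, 0⟩ : VariableChange ℚ) • (tateFormOfJ j).quadraticTwist d =
      ⟨1, (d - 1) / 4, 0, d ^ 2 * (tateFormOfJ j).a₄, d ^ 3 * (tateFormOfJ j).a₆⟩ := by
  ext
  · rw [variableChange_a₁]; simp
  · rw [variableChange_a₂]
    simp only [quadraticTwist_a₁, quadraticTwist_a₂, WeierstrassCurve.b₂, tateFormOfJ_a₁,
      tateFormOfJ_a₂, inv_one, Units.val_one]
    ring
  · rw [variableChange_a₃]; simp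
  · rw [variableChange_a₄]
    simp only [quadraticTwist_a₁, quadraticTwist_a₂, quadraticTwist_a₃, quadraticTwist_a₄,
      WeierstrassCurve.b₂, WeierstrassCurve.b₄, tateFormOfJ_a₁, tateFormOfJ_a₂, tateFormOfJ_a₃,
      inv_one, Units.val_one]
    ring
  · rw [variableChange_a₆]
    simp only [quadraticTwist_a₁, quadraticTwist_a₂, quadraticTwist_a₃, quadraticTwist_a₄,
      quadraticTwist_a₆, WeierstrassCurve.b₂, WeierstrassCurve.b₄, WeierstrassCurve.b₆,
      tateFormOfJ_a₁, tateFormOfJ_a₂, tateFormOfJ_a₃, inv_one, Units.val_one]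
    ring

end Models

/-! ### `d ≡ 3 (mod 4)`: type `I*_{ν+4}`, `ord₂ Δ_min = ν + 12`, `f₂ = 4`, `δ₂ = 2` -/

section CaseA

variable (v : HeightOneSpectrum (𝓞 ℚ))

/-- **Kodaira type `I*_{ν+4}` and `ord₂(Δ_min) = ν + 12` for `E ≅ T^{(d)}`, `d ≡ 3 (mod 4)`,
`ord₂(j) = -ν < 0`.**  The model `M = y² + 2xy = x³ + (d-1)x² + 16d²a₄x + 64d³a₆` of `E` over
`ℚ` is `2`-integral with `|a₄|, |a₆| = 2^{-(ν+6)}`, `|Δ| = 2^{-(ν+12)}`, `|c₄| = 2⁻⁴`; it is minimal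
at `2` because the only possible descent `u = 2w` would give `c₄' = d²c₄(T)/w⁴` (a unit) and
`c₆' + 1 = (d³c₆(T) + w⁶)/w⁶` of valuation `2⁻¹` (`c₆(T) ≡ -1 (mod 64)`, `w⁶ ≡ 1 (mod 8)`,
`1 - d³ ≡ 2 (mod 4)`), violating Kraus's necessary condition; and Tate's algorithm on its
`ℤ₂`-structure is family A of `TateAlgorithmIstarCharTwoProofs` with `N = ν + 6`
(`a₁ = 2 = ϖε`, `a₂ = d - 1 = ϖ·ε(d-1)/2`).  Silverman *ATAEC* IV.9.4; Kraus 1989 Prop. 2.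
[cite: SilvermanATAEC1994, IV.9.4 (PDF pp. 344–346) and Table 4.1] [cite: Kraus1989, Prop. 2] -/
theorem kodairaSymbolAt_and_ordMinimalDiscriminant_of_emod_four_eq_three
    [PerfectField (IsLocalRing.ResidueField (v.adicCompletionIntegers ℚ))]
    (hv : natGenerator v = 2) (W : WeierstrassCurve ℚ) [W.IsElliptic]
    (hj : 1 < v.valuation ℚ W.j) {ν : ℕ} (hν : v.valuation ℚ W.j = WithZero.exp (ν : ℤ))
    {d : ℤ} (hd : d % 4 = 3) {C : VariableChange ℚ}
    (hC : C • W = (tateFormOfJ W.j).quadraticTwist (d : ℚ)) :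
    W.kodairaSymbolAt v = .Istar (ν + 4) ∧ W.ordMinimalDiscriminant v = ν + 12 := by
  obtain ⟨hj0, hj1728, -⟩ := W.j_ne_and_valuation_j_sub_eq_of_one_lt_valuation_j v hj
  obtain ⟨ha₄, ha₆, hΔT, hc₆T⟩ := valuation_tateFormOfJ_of_natGenerator_eq_two v W hv hj hν
  obtain ⟨hc₄T, -⟩ := W.valuation_c₄_tateFormOfJ_eq_one_and_valuation_Δ_lt_one v hj
  have hν1 : 1 ≤ ν := by
    have h1 : WithZero.exp (0 : ℤ) < WithZero.exp (ν : ℤ) := by rw [WithZero.exp_zero, ← hν]; exact hj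
    rw [WithZero.exp_lt_exp] at h1; omega
  -- valuations of `2` and `d` at `v`
  have hv2 : v.valuation ℚ (2 : ℚ) = WithZero.exp (-1 : ℤ) := by
    have := Rat.valuation_natGenerator v; rwa [hv, Nat.cast_ofNat] at this
  have hvd : v.valuation ℚ (d : ℚ) = 1 :=
    Rat.valuation_intCast_eq_one v (by rw [hv]; exact_mod_cast (show ¬ (2 : ℤ) ∣ d by omega))
  have hvpow : ∀ k : ℕ, v.valuation ℚ ((2 : ℚ) ^ k) = WithZero.exp (-(k : ℤ)) := fun k ↦ by
    rw [map_pow, hv2, ← WithZero.exp_nsmul]; simp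
  -- the model `M` over `ℚ`
  set T := tateFormOfJ W.j with hT
  set CA : VariableChange ℚ := ⟨⟨2⁻¹, 2, by norm_num, by norm_num⟩, 0, 2⁻¹, 0⟩ with hCA
  set M : WeierstrassCurve ℚ := (CA * C) • W with hM
  have hM' : M = ⟨2, (d : ℚ) - 1, 0, 16 * (d : ℚ) ^ 2 * T.a₄, 64 * (d : ℚ) ^ 3 * T.a₆⟩ := by
    rw [hM, mul_smul, hC]; exact smul_quadraticTwist_tateFormOfJ_eq_modelA W.j d
  have hMa₁ : M.a₁ = 2 := by rw [hM']
  have hMa₂ : M.a₂ = (d : ℚ) - 1 := by rw [hM']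
  have hMa₃ : M.a₃ = 0 := by rw [hM']
  have hMa₄ : M.a₄ = 16 * (d : ℚ) ^ 2 * T.a₄ := by rw [hM']
  have hMa₆ : M.a₆ = 64 * (d : ℚ) ^ 3 * T.a₆ := by rw [hM']
  have hCAu : ((CA.u⁻¹ : ℚˣ) : ℚ) = 2 := by rw [hCA]; simp
  have hMΔ : M.Δ = 2 ^ 12 * (d : ℚ) ^ 6 * T.Δ := by
    rw [hM, mul_smul, hC, variableChange_Δ, quadraticTwist_Δ, hCAu]; ring
  have hMc₄ : M.c₄ = 2 ^ 4 * (d : ℚ) ^ 2 * T.c₄ := by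
    rw [hM, mul_smul, hC, variableChange_c₄, quadraticTwist_c₄, hCAu]; ring
  have hMc₆ : M.c₆ = 2 ^ 6 * (d : ℚ) ^ 3 * T.c₆ := by
    rw [hM, mul_smul, hC, variableChange_c₆, quadraticTwist_c₆, hCAu]; ring
  -- valuations of `M` at `v`
  have hvMa₄ : v.valuation ℚ M.a₄ = WithZero.exp (-((ν + 6 : ℕ) : ℤ)) := by
    rw [hMa₄, show (16 : ℚ) = 2 ^ 4 by norm_num, map_mul, map_mul, hvpow, map_pow, hvd, one_pow,
      mul_one, ha₄, withZero_exp_mul_exp]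
    congr 1; push_cast; ring
  have hvMa₆ : v.valuation ℚ M.a₆ = WithZero.exp (-((ν + 6 : ℕ) : ℤ)) := by
    rw [hMa₆, show (64 : ℚ) = 2 ^ 6 by norm_num, map_mul, map_mul, hvpow, map_pow, hvd, one_pow,
      mul_one, ha₆, withZero_exp_mul_exp]
    congr 1; push_cast; ring
  have hvMΔ : v.valuation ℚ M.Δ = WithZero.exp (-((ν + 12 : ℕ) : ℤ)) := by
    rw [hMΔ, map_mul, map_mul, hvpow, map_pow, hvd, one_pow, mul_one, hΔT, withZero_exp_mul_exp]
    congr 1; push_cast; ring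
  have hvMc₄ : v.valuation ℚ M.c₄ = WithZero.exp (-4 : ℤ) := by
    rw [hMc₄, map_mul, map_mul, hvpow, map_pow, hvd, one_pow, mul_one, hc₄T, mul_one]; rfl
  -- the base change `X` to `ℚ_v` is integral …
  have hexp1 : ∀ k : ℕ, WithZero.exp (-(k : ℤ)) ≤ (1 : WithZero (Multiplicative ℤ)) := fun k ↦ by
    rw [← WithZero.exp_zero, WithZero.exp_le_exp]; omega
  have hint : M.IsIntegralAt v := by
    refine M.isIntegralAt_of_valuation_le_one v ?_ ?_ ?_ ?_ ?_
    · rw [hMa₁, hv2]; exact hexp1 1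
    · have e : ((d : ℚ) - 1) = algebraMap (𝓞 ℚ) ℚ ((d : 𝓞 ℚ) - 1) := by simp
      rw [hMa₂, e]; exact v.valuation_le_one _
    · rw [hMa₃, map_zero]; exact zero_le_one
    · rw [hvMa₄]; exact hexp1 _
    · rw [hvMa₆]; exact hexp1 _
  set X := M.baseChange (v.adicCompletion ℚ) with hX
  haveI hXint : X.IsIntegral (v.adicCompletionIntegers ℚ) := hint
  have hXc₄ : Valued.v X.c₄ = WithZero.exp (-4 : ℤ) := by
    rw [hX, WeierstrassCurve.baseChange, map_c₄, valued_algebraMap_adicCompletion, hvMc₄]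
  have hXc₆ : X.c₆ = 64 * (d : v.adicCompletion ℚ) ^ 3 * algebraMap ℚ (v.adicCompletion ℚ) T.c₆ := by
    rw [hX, WeierstrassCurve.baseChange, map_c₆, hMc₆, map_mul, map_mul, map_pow, map_pow,
      map_intCast, map_ofNat]; norm_num
  have hXΔ : Valued.v X.Δ = WithZero.exp (-((ν + 12 : ℕ) : ℤ)) := by
    rw [hX, WeierstrassCurve.baseChange, map_Δ, valued_algebraMap_adicCompletion, hvMΔ]
  -- … and minimal (Kraus)
  have V2 := valued_two v hv
  have h20 : (2 : v.adicCompletion ℚ) ≠ 0 := by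
    intro h; rw [h, Valuation.map_zero] at V2; exact WithZero.coe_ne_zero V2.symm
  have Vd : Valued.v (d : v.adicCompletion ℚ) = 1 := by
    rw [← map_intCast (algebraMap ℚ (v.adicCompletion ℚ)) d, valued_algebraMap_adicCompletion, hvd]
  have hd3 : (1 - d ^ 3) % 4 = 2 := by
    have : d ^ 3 % 4 = 3 := by
      rw [pow_succ, pow_two, Int.mul_emod, Int.mul_emod d d, hd]; norm_num
    omega
  obtain ⟨k, hk, hkodd⟩ : ∃ k : ℤ, 1 - d ^ 3 = 2 * k ∧ ¬ (2 : ℤ) ∣ k :=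
    ⟨(1 - d ^ 3) / 2, by omega, by omega⟩
  have V1d3 : Valued.v (1 - (d : v.adicCompletion ℚ) ^ 3) = WithZero.exp (-1 : ℤ) := by
    have e : (1 - (d : v.adicCompletion ℚ) ^ 3) = 2 * (k : v.adicCompletion ℚ) := by exact_mod_cast congrArg (Int.cast : ℤ → v.adicCompletion ℚ) hk
    have Vk : Valued.v (k : v.adicCompletion ℚ) = 1 := by
      rw [← map_intCast (algebraMap ℚ (v.adicCompletion ℚ)) k, valued_algebraMap_adicCompletion]
      exact Rat.valuation_intCast_eq_one v (by rw [hv]; exact_mod_cast hkodd)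
    rw [e, Valuation.map_mul, V2, Vk, mul_one]
  have Vc₆1 : Valued.v (algebraMap ℚ (v.adicCompletion ℚ) T.c₆ + 1) ≤ WithZero.exp (-6 : ℤ) := by
    rw [← map_one (algebraMap ℚ (v.adicCompletion ℚ)), ← map_add, valued_algebraMap_adicCompletion]
    exact hc₆T.trans (WithZero.exp_le_exp.mpr (by push_cast; omega))
  haveI hmin : X.IsMinimal (v.adicCompletionIntegers ℚ) := by
    refine isMinimal_of_kraus_fails v hv X (by rw [hXc₄]; exact WithZero.exp_lt_exp.mpr (by norm_num))
      fun w hw hK ↦ ?_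
    have hw0 : w ≠ 0 := by
      intro h; rw [h, Valuation.map_zero] at hw; exact zero_ne_one hw
    have V16 : Valued.v (16 : v.adicCompletion ℚ) = WithZero.exp (-4 : ℤ) := by
      rw [show (16 : v.adicCompletion ℚ) = 2 ^ 4 by norm_num, Valuation.map_pow, V2,
        ← WithZero.exp_nsmul]; norm_num
    rcases hK with ⟨h4, -⟩ | h6
    · rw [map_div₀, hXc₄, Valuation.map_mul, Valuation.map_pow, hw, one_pow, mul_one, V16,
        div_self WithZero.coe_ne_zero, ← WithZero.exp_zero, WithZero.exp_le_exp] at h4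
      omega
    · have e : X.c₆ / (64 * w ^ 6) + 1 =
          ((d : v.adicCompletion ℚ) ^ 3 * algebraMap ℚ (v.adicCompletion ℚ) T.c₆ + w ^ 6) / w ^ 6 := by
        have h64 : (64 : v.adicCompletion ℚ) ≠ 0 := by
          rw [show (64 : v.adicCompletion ℚ) = 2 ^ 6 by norm_num]; exact pow_ne_zero _ h20
        rw [hXc₆]; field_simp
      have e' : (d : v.adicCompletion ℚ) ^ 3 * algebraMap ℚ (v.adicCompletion ℚ) T.c₆ + w ^ 6 =
          (1 - (d : v.adicCompletion ℚ) ^ 3) +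
            ((d : v.adicCompletion ℚ) ^ 3 * (algebraMap ℚ (v.adicCompletion ℚ) T.c₆ + 1) + (w ^ 6 - 1)) := by
        ring
      have hrest : Valued.v ((d : v.adicCompletion ℚ) ^ 3 * (algebraMap ℚ (v.adicCompletion ℚ) T.c₆ + 1) +
          (w ^ 6 - 1)) < Valued.v (1 - (d : v.adicCompletion ℚ) ^ 3) := by
        rw [V1d3]
        refine lt_of_le_of_lt (Valuation.map_add_le _ ?_ (valued_pow_six_sub_one_le v hv hw)) ?_
        · rw [Valuation.map_mul, Valuation.map_pow, Vd, one_pow, one_mul]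
          exact Vc₆1.trans (WithZero.exp_le_exp.mpr (by norm_num))
        · exact WithZero.exp_lt_exp.mpr (by norm_num)
      rw [e, map_div₀, Valuation.map_pow, hw, one_pow, div_one, e',
        Valuation.map_add_eq_of_lt_left _ hrest, V1d3, WithZero.exp_le_exp] at h6
      omega
  -- the integral model over `ℤ₂ = O_v` and its coefficients
  have hinj : Function.Injective (algebraMap (v.adicCompletionIntegers ℚ) (v.adicCompletion ℚ)) :=
    IsFractionRing.injective _ _
  obtain ⟨ε, hεu, h2ε⟩ := exists_isUnit_two_eq_uniformizer_mul v hv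
  set ϖ := uniformizer (v.adicCompletionIntegers ℚ) with hϖ
  have e1 : (X.integralModel (v.adicCompletionIntegers ℚ)).a₁ = ϖ * ε := by
    rw [← h2ε]; apply hinj
    rw [integralModel_a₁_eq, hX, WeierstrassCurve.baseChange, map_a₁, hMa₁, map_ofNat, map_ofNat]
  have e3 : (X.integralModel (v.adicCompletionIntegers ℚ)).a₃ = 0 := by
    apply hinj
    rw [integralModel_a₃_eq, hX, WeierstrassCurve.baseChange, map_a₃, hMa₃, map_zero, map_zero]
  obtain ⟨δ₀, hδ₀, hδ₀odd⟩ : ∃ δ₀ : ℤ, d - 1 = 2 * δ₀ ∧ ¬ (2 : ℤ) ∣ δ₀ := ⟨(d - 1) / 2, by omega, by omega⟩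
  have e2 : (X.integralModel (v.adicCompletionIntegers ℚ)).a₂ = ϖ * (ε * (δ₀ : v.adicCompletionIntegers ℚ)) := by
    rw [← mul_assoc, ← h2ε]; apply hinj
    rw [integralModel_a₂_eq, hX, WeierstrassCurve.baseChange, map_a₂, hMa₂, map_sub, map_one,
      map_intCast, map_mul, map_ofNat, map_intCast]
    exact_mod_cast congrArg (Int.cast : ℤ → v.adicCompletion ℚ) hδ₀
  have hδ₀u : IsUnit ((δ₀ : ℤ) : v.adicCompletionIntegers ℚ) := by
    rw [HeightOneSpectrum.adicCompletionIntegers.isUnit_iff_valued_eq_one]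
    push_cast
    rw [← map_intCast (algebraMap ℚ (v.adicCompletion ℚ)) δ₀, valued_algebraMap_adicCompletion]
    exact Rat.valuation_intCast_eq_one v (by rw [hv]; exact_mod_cast hδ₀odd)
  have hβ : IsUnit (ε * (δ₀ : v.adicCompletionIntegers ℚ)) := hεu.mul hδ₀u
  have hvMOa₄ : Valued.v (((X.integralModel (v.adicCompletionIntegers ℚ)).a₄ : v.adicCompletionIntegers ℚ) : v.adicCompletion ℚ) =
      WithZero.exp (-((ν + 6 : ℕ) : ℤ)) := by
    rw [show (((X.integralModel (v.adicCompletionIntegers ℚ)).a₄ : v.adicCompletionIntegers ℚ) :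
        v.adicCompletion ℚ) = X.a₄ from integralModel_a₄_eq (v.adicCompletionIntegers ℚ) X, hX, WeierstrassCurve.baseChange, map_a₄,
      valued_algebraMap_adicCompletion, hvMa₄]
  have hvMOa₆ : Valued.v (((X.integralModel (v.adicCompletionIntegers ℚ)).a₆ : v.adicCompletionIntegers ℚ) : v.adicCompletion ℚ) =
      WithZero.exp (-((ν + 6 : ℕ) : ℤ)) := by
    rw [show (((X.integralModel (v.adicCompletionIntegers ℚ)).a₆ : v.adicCompletionIntegers ℚ) :
        v.adicCompletion ℚ) = X.a₆ from integralModel_a₆_eq (v.adicCompletionIntegers ℚ) X, hX, WeierstrassCurve.baseChange, map_a₆,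
      valued_algebraMap_adicCompletion, hvMa₆]
  have hvMOΔ : Valued.v (((X.integralModel (v.adicCompletionIntegers ℚ)).Δ : v.adicCompletionIntegers ℚ) : v.adicCompletion ℚ) =
      WithZero.exp (-((ν + 12 : ℕ) : ℤ)) := by
    rw [show (((X.integralModel (v.adicCompletionIntegers ℚ)).Δ : v.adicCompletionIntegers ℚ) :
        v.adicCompletion ℚ) = X.Δ from integralModel_Δ_eq (v.adicCompletionIntegers ℚ) X, hXΔ]
  have e4 : ϖ ^ (ν + 6) ∣ (X.integralModel (v.adicCompletionIntegers ℚ)).a₄ := uniformizer_pow_dvd_of_valued_le v hvMOa₄.le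
  obtain ⟨γ, hγ, e6⟩ := exists_isUnit_eq_uniformizer_pow_mul_of_valued_eq v hvMOa₆
  have hordΔ : (IsDiscreteValuationRing.addVal (v.adicCompletionIntegers ℚ) (X.integralModel (v.adicCompletionIntegers ℚ)).Δ).toNat = ν + 12 :=
    addVal_toNat_eq_of_valued_eq v hvMOΔ
  -- Tate's algorithm: family A with `N = ν + 6`
  have hK : (X.integralModel (v.adicCompletionIntegers ℚ)).kodairaSymbolOfMinimal = .Istar (ν + 6 - 2) :=
    kodairaSymbolOfMinimal_familyA (N := ν + 6) (by omega) (by rw [hordΔ]; omega) h2ε hεu e1 hεu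
      e2 hβ e3 e4 e6 hγ
  -- read `kodairaSymbolAt` and `ord Δ_min` on the minimal model `X`
  haveI hXell : X.IsElliptic := by rw [hX, WeierstrassCurve.baseChange]; infer_instance
  have hrel : X = ((CA * C).map (algebraMap ℚ (v.adicCompletion ℚ))) •
      W.baseChange (v.adicCompletion ℚ) := by
    rw [hX, hM, WeierstrassCurve.baseChange, WeierstrassCurve.baseChange, map_variableChange]
  refine ⟨?_, ?_⟩
  · rw [W.kodairaSymbolAt_eq_kodairaSymbolOfMinimal_of_isMinimal v X _ hrel X.isUnit_Δ.ne_zero, hK,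
      show ν + 6 - 2 = ν + 4 by omega]
  · rw [W.ordMinimalDiscriminant_eq_of_isMinimal v X _ hrel X.isUnit_Δ.ne_zero, hordΔ]

/-- **Kodaira type `I*_{ν+8}` and `ord₂(Δ_min) = ν + 18` for `E ≅ T^{(d)}`, `d ≡ 2 (mod 4)`,
`ord₂(j) = -ν < 0`.**  The model `M = y² = x³ + dx² + 16d²a₄x + 64d³a₆` of `E` over `ℚ` is
`2`-integral with `|a₄| = 2^{-(ν+8)}`, `|a₆| = 2^{-(ν+9)}`, `|Δ| = 2^{-(ν+18)}`, `|c₄| = 2⁻⁶`; it is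
minimal at `2` (the descent `u = 2w` would give `|c₄'| = 2⁻²` and `c₆' + 1` a unit, violating
Kraus's necessary condition), and Tate's algorithm on its `ℤ₂`-structure is family B of
`TateAlgorithmIstarCharTwoProofs` with `N = ν + 9` (`a₂ = d = ϖ·ε(d/2)`).  Silverman *ATAEC*
IV.9.4; Kraus 1989 Prop. 2.
[cite: SilvermanATAEC1994, IV.9.4 (PDF pp. 344–346) and Table 4.1] [cite: Kraus1989, Prop. 2] -/
theorem kodairaSymbolAt_and_ordMinimalDiscriminant_of_emod_four_eq_two
    [PerfectField (IsLocalRing.ResidueField (v.adicCompletionIntegers ℚ))]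
    (hv : natGenerator v = 2) (W : WeierstrassCurve ℚ) [W.IsElliptic]
    (hj : 1 < v.valuation ℚ W.j) {ν : ℕ} (hν : v.valuation ℚ W.j = WithZero.exp (ν : ℤ))
    {d : ℤ} (hd : d % 4 = 2) {C : VariableChange ℚ}
    (hC : C • W = (tateFormOfJ W.j).quadraticTwist (d : ℚ)) :
    W.kodairaSymbolAt v = .Istar (ν + 8) ∧ W.ordMinimalDiscriminant v = ν + 18 := by
  obtain ⟨hj0, hj1728, -⟩ := W.j_ne_and_valuation_j_sub_eq_of_one_lt_valuation_j v hj
  obtain ⟨ha₄, ha₆, hΔT, hc₆T⟩ := valuation_tateFormOfJ_of_natGenerator_eq_two v W hv hj hν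
  obtain ⟨hc₄T, -⟩ := W.valuation_c₄_tateFormOfJ_eq_one_and_valuation_Δ_lt_one v hj
  have hν1 : 1 ≤ ν := by
    have h1 : WithZero.exp (0 : ℤ) < WithZero.exp (ν : ℤ) := by rw [WithZero.exp_zero, ← hν]; exact hj
    rw [WithZero.exp_lt_exp] at h1; omega
  -- valuations of `2` and `d` at `v`
  have hv2 : v.valuation ℚ (2 : ℚ) = WithZero.exp (-1 : ℤ) := by
    have := Rat.valuation_natGenerator v; rwa [hv, Nat.cast_ofNat] at this
  obtain ⟨d', hd', hd'odd⟩ : ∃ d' : ℤ, d = 2 * d' ∧ ¬ (2 : ℤ) ∣ d' := ⟨d / 2, by omega, by omega⟩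
  have hvd' : v.valuation ℚ (d' : ℚ) = 1 :=
    Rat.valuation_intCast_eq_one v (by rw [hv]; exact_mod_cast hd'odd)
  have hvd : v.valuation ℚ (d : ℚ) = WithZero.exp (-1 : ℤ) := by
    rw [hd', Int.cast_mul, Int.cast_ofNat, map_mul, hv2, hvd', mul_one]
  have hvpow : ∀ k : ℕ, v.valuation ℚ ((2 : ℚ) ^ k) = WithZero.exp (-(k : ℤ)) := fun k ↦ by
    rw [map_pow, hv2, ← WithZero.exp_nsmul]; simp
  -- the model `M` over `ℚ`
  set T := tateFormOfJ W.j with hT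
  set CA : VariableChange ℚ := ⟨⟨2⁻¹, 2, by norm_num, by norm_num⟩, 0, 0, 0⟩ with hCA
  set M : WeierstrassCurve ℚ := (CA * C) • W with hM
  have hM' : M = ⟨0, (d : ℚ), 0, 16 * (d : ℚ) ^ 2 * T.a₄, 64 * (d : ℚ) ^ 3 * T.a₆⟩ := by
    rw [hM, mul_smul, hC]; exact smul_quadraticTwist_tateFormOfJ_eq_modelB W.j d
  have hMa₁ : M.a₁ = 0 := by rw [hM']
  have hMa₂ : M.a₂ = (d : ℚ) := by rw [hM']
  have hMa₃ : M.a₃ = 0 := by rw [hM']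
  have hMa₄ : M.a₄ = 16 * (d : ℚ) ^ 2 * T.a₄ := by rw [hM']
  have hMa₆ : M.a₆ = 64 * (d : ℚ) ^ 3 * T.a₆ := by rw [hM']
  have hCAu : ((CA.u⁻¹ : ℚˣ) : ℚ) = 2 := by rw [hCA]; simp
  have hMΔ : M.Δ = 2 ^ 12 * (d : ℚ) ^ 6 * T.Δ := by
    rw [hM, mul_smul, hC, variableChange_Δ, quadraticTwist_Δ, hCAu]; ring
  have hMc₄ : M.c₄ = 2 ^ 4 * (d : ℚ) ^ 2 * T.c₄ := by
    rw [hM, mul_smul, hC, variableChange_c₄, quadraticTwist_c₄, hCAu]; ring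
  have hMc₆ : M.c₆ = 2 ^ 6 * (d : ℚ) ^ 3 * T.c₆ := by
    rw [hM, mul_smul, hC, variableChange_c₆, quadraticTwist_c₆, hCAu]; ring
  -- valuations of `M` at `v`
  have hvMa₄ : v.valuation ℚ M.a₄ = WithZero.exp (-((ν + 8 : ℕ) : ℤ)) := by
    rw [hMa₄, show (16 : ℚ) = 2 ^ 4 by norm_num, map_mul, map_mul, hvpow, map_pow, hvd,
      ← WithZero.exp_nsmul, ha₄, withZero_exp_mul_exp, withZero_exp_mul_exp]
    congr 1; push_cast; ring
  have hvMa₆ : v.valuation ℚ M.a₆ = WithZero.exp (-((ν + 9 : ℕ) : ℤ)) := by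
    rw [hMa₆, show (64 : ℚ) = 2 ^ 6 by norm_num, map_mul, map_mul, hvpow, map_pow, hvd,
      ← WithZero.exp_nsmul, ha₆, withZero_exp_mul_exp, withZero_exp_mul_exp]
    congr 1; push_cast; ring
  have hvMΔ : v.valuation ℚ M.Δ = WithZero.exp (-((ν + 18 : ℕ) : ℤ)) := by
    rw [hMΔ, map_mul, map_mul, hvpow, map_pow, hvd, ← WithZero.exp_nsmul, hΔT, withZero_exp_mul_exp,
      withZero_exp_mul_exp]
    congr 1; push_cast; ring
  have hvMc₄ : v.valuation ℚ M.c₄ = WithZero.exp (-6 : ℤ) := by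
    rw [hMc₄, map_mul, map_mul, hvpow, map_pow, hvd, ← WithZero.exp_nsmul, hc₄T, mul_one,
      withZero_exp_mul_exp]
    congr 1
  -- the base change `X` to `ℚ_v` is integral …
  have hexp1 : ∀ k : ℕ, WithZero.exp (-(k : ℤ)) ≤ (1 : WithZero (Multiplicative ℤ)) := fun k ↦ by
    rw [← WithZero.exp_zero, WithZero.exp_le_exp]; omega
  have hint : M.IsIntegralAt v := by
    refine M.isIntegralAt_of_valuation_le_one v ?_ ?_ ?_ ?_ ?_
    · rw [hMa₁, map_zero]; exact zero_le_one
    · rw [hMa₂, hvd]; exact hexp1 1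
    · rw [hMa₃, map_zero]; exact zero_le_one
    · rw [hvMa₄]; exact hexp1 _
    · rw [hvMa₆]; exact hexp1 _
  set X := M.baseChange (v.adicCompletion ℚ) with hX
  haveI hXint : X.IsIntegral (v.adicCompletionIntegers ℚ) := hint
  have hXc₄ : Valued.v X.c₄ = WithZero.exp (-6 : ℤ) := by
    rw [hX, WeierstrassCurve.baseChange, map_c₄, valued_algebraMap_adicCompletion, hvMc₄]
  have hXc₆ : X.c₆ = 64 * (d : v.adicCompletion ℚ) ^ 3 * algebraMap ℚ (v.adicCompletion ℚ) T.c₆ := by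
    rw [hX, WeierstrassCurve.baseChange, map_c₆, hMc₆, map_mul, map_mul, map_pow, map_pow,
      map_intCast, map_ofNat]; norm_num
  have hXΔ : Valued.v X.Δ = WithZero.exp (-((ν + 18 : ℕ) : ℤ)) := by
    rw [hX, WeierstrassCurve.baseChange, map_Δ, valued_algebraMap_adicCompletion, hvMΔ]
  -- … and minimal (Kraus)
  have V2 := valued_two v hv
  have h20 : (2 : v.adicCompletion ℚ) ≠ 0 := by
    intro h; rw [h, Valuation.map_zero] at V2; exact WithZero.coe_ne_zero V2.symm
  have Vd : Valued.v (d : v.adicCompletion ℚ) = WithZero.exp (-1 : ℤ) := by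
    rw [← map_intCast (algebraMap ℚ (v.adicCompletion ℚ)) d, valued_algebraMap_adicCompletion, hvd]
  have Vc₆1 : Valued.v (algebraMap ℚ (v.adicCompletion ℚ) T.c₆ + 1) ≤ WithZero.exp (-6 : ℤ) := by
    rw [← map_one (algebraMap ℚ (v.adicCompletion ℚ)), ← map_add, valued_algebraMap_adicCompletion]
    exact hc₆T.trans (WithZero.exp_le_exp.mpr (by push_cast; omega))
  have Vc₆ : Valued.v (algebraMap ℚ (v.adicCompletion ℚ) T.c₆) = 1 := by
    have e : algebraMap ℚ (v.adicCompletion ℚ) T.c₆ = -1 + (algebraMap ℚ (v.adicCompletion ℚ) T.c₆ + 1) := by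
      ring
    rw [e, Valuation.map_add_eq_of_lt_left _ (by
      rw [Valuation.map_neg, Valuation.map_one]
      exact lt_of_le_of_lt Vc₆1 (WithZero.exp_lt_exp.mpr (by norm_num) |>.trans_eq WithZero.exp_zero)),
      Valuation.map_neg, Valuation.map_one]
  haveI hmin : X.IsMinimal (v.adicCompletionIntegers ℚ) := by
    refine isMinimal_of_kraus_fails v hv X (by rw [hXc₄]; exact WithZero.exp_lt_exp.mpr (by norm_num))
      fun w hw hK ↦ ?_
    have hw0 : w ≠ 0 := by
      intro h; rw [h, Valuation.map_zero] at hw; exact zero_ne_one hw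
    have V16 : Valued.v (16 : v.adicCompletion ℚ) = WithZero.exp (-4 : ℤ) := by
      rw [show (16 : v.adicCompletion ℚ) = 2 ^ 4 by norm_num, Valuation.map_pow, V2,
        ← WithZero.exp_nsmul]; norm_num
    have V64 : Valued.v (64 : v.adicCompletion ℚ) = WithZero.exp (-6 : ℤ) := by
      rw [show (64 : v.adicCompletion ℚ) = 2 ^ 6 by norm_num, Valuation.map_pow, V2,
        ← WithZero.exp_nsmul]; norm_num
    rcases hK with ⟨h4, -⟩ | h6
    · rw [map_div₀, hXc₄, Valuation.map_mul, Valuation.map_pow, hw, one_pow, mul_one, V16,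
        div_eq_mul_inv, ← WithZero.exp_neg, withZero_exp_mul_exp, WithZero.exp_le_exp] at h4
      omega
    · have hlt : Valued.v (X.c₆ / (64 * w ^ 6)) < Valued.v (1 : v.adicCompletion ℚ) := by
        rw [hXc₆, map_div₀, Valuation.map_mul, Valuation.map_mul, Valuation.map_mul,
          Valuation.map_pow, Valuation.map_pow, V64, Vd, Vc₆, hw, one_pow, mul_one, mul_one,
          Valuation.map_one, ← WithZero.exp_nsmul, withZero_exp_mul_exp, div_eq_mul_inv,
          ← WithZero.exp_neg, withZero_exp_mul_exp, ← WithZero.exp_zero, WithZero.exp_lt_exp]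
        norm_num
      rw [add_comm, Valuation.map_add_eq_of_lt_left _ hlt, Valuation.map_one, ← WithZero.exp_zero,
        WithZero.exp_le_exp] at h6
      omega
  -- the integral model over `ℤ₂ = O_v` and its coefficients
  have hinj : Function.Injective (algebraMap (v.adicCompletionIntegers ℚ) (v.adicCompletion ℚ)) :=
    IsFractionRing.injective _ _
  obtain ⟨ε, hεu, h2ε⟩ := exists_isUnit_two_eq_uniformizer_mul v hv
  set ϖ := uniformizer (v.adicCompletionIntegers ℚ) with hϖ
  have e1 : (X.integralModel (v.adicCompletionIntegers ℚ)).a₁ = 0 := by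
    apply hinj
    rw [integralModel_a₁_eq, hX, WeierstrassCurve.baseChange, map_a₁, hMa₁, map_zero, map_zero]
  have e3 : (X.integralModel (v.adicCompletionIntegers ℚ)).a₃ = 0 := by
    apply hinj
    rw [integralModel_a₃_eq, hX, WeierstrassCurve.baseChange, map_a₃, hMa₃, map_zero, map_zero]
  have e2 : (X.integralModel (v.adicCompletionIntegers ℚ)).a₂ = ϖ * (ε * (d' : v.adicCompletionIntegers ℚ)) := by
    rw [← mul_assoc, ← h2ε]; apply hinj
    rw [integralModel_a₂_eq, hX, WeierstrassCurve.baseChange, map_a₂, hMa₂, map_intCast, map_mul,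
      map_ofNat, map_intCast]
    exact_mod_cast congrArg (Int.cast : ℤ → v.adicCompletion ℚ) hd'
  have hd'u : IsUnit ((d' : ℤ) : v.adicCompletionIntegers ℚ) := by
    rw [HeightOneSpectrum.adicCompletionIntegers.isUnit_iff_valued_eq_one]
    push_cast
    rw [← map_intCast (algebraMap ℚ (v.adicCompletion ℚ)) d', valued_algebraMap_adicCompletion]
    exact hvd'
  have hβ : IsUnit (ε * (d' : v.adicCompletionIntegers ℚ)) := hεu.mul hd'u
  have hvMOa₄ : Valued.v (((X.integralModel (v.adicCompletionIntegers ℚ)).a₄ : v.adicCompletionIntegers ℚ) : v.adicCompletion ℚ) =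
      WithZero.exp (-((ν + 8 : ℕ) : ℤ)) := by
    rw [show (((X.integralModel (v.adicCompletionIntegers ℚ)).a₄ : v.adicCompletionIntegers ℚ) :
        v.adicCompletion ℚ) = X.a₄ from integralModel_a₄_eq (v.adicCompletionIntegers ℚ) X, hX, WeierstrassCurve.baseChange, map_a₄,
      valued_algebraMap_adicCompletion, hvMa₄]
  have hvMOa₆ : Valued.v (((X.integralModel (v.adicCompletionIntegers ℚ)).a₆ : v.adicCompletionIntegers ℚ) : v.adicCompletion ℚ) =
      WithZero.exp (-((ν + 9 : ℕ) : ℤ)) := by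
    rw [show (((X.integralModel (v.adicCompletionIntegers ℚ)).a₆ : v.adicCompletionIntegers ℚ) :
        v.adicCompletion ℚ) = X.a₆ from integralModel_a₆_eq (v.adicCompletionIntegers ℚ) X, hX, WeierstrassCurve.baseChange, map_a₆,
      valued_algebraMap_adicCompletion, hvMa₆]
  have hvMOΔ : Valued.v (((X.integralModel (v.adicCompletionIntegers ℚ)).Δ : v.adicCompletionIntegers ℚ) : v.adicCompletion ℚ) =
      WithZero.exp (-((ν + 18 : ℕ) : ℤ)) := by
    rw [show (((X.integralModel (v.adicCompletionIntegers ℚ)).Δ : v.adicCompletionIntegers ℚ) :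
        v.adicCompletion ℚ) = X.Δ from integralModel_Δ_eq (v.adicCompletionIntegers ℚ) X, hXΔ]
  have e4 : ϖ ^ (ν + 9 - 1) ∣ (X.integralModel (v.adicCompletionIntegers ℚ)).a₄ := by
    rw [show ν + 9 - 1 = ν + 8 by omega]; exact uniformizer_pow_dvd_of_valued_le v hvMOa₄.le
  obtain ⟨γ, hγ, e6⟩ := exists_isUnit_eq_uniformizer_pow_mul_of_valued_eq v hvMOa₆
  have hordΔ : (IsDiscreteValuationRing.addVal (v.adicCompletionIntegers ℚ) (X.integralModel (v.adicCompletionIntegers ℚ)).Δ).toNat = ν + 18 :=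
    addVal_toNat_eq_of_valued_eq v hvMOΔ
  -- Tate's algorithm: family B with `N = ν + 9`
  have hK : (X.integralModel (v.adicCompletionIntegers ℚ)).kodairaSymbolOfMinimal = .Istar (ν + 9 - 1) :=
    kodairaSymbolOfMinimal_familyB (N := ν + 9) (by omega) (by rw [hordΔ]; omega) h2ε hεu e1
      e2 hβ e3 e4 e6 hγ
  -- read `kodairaSymbolAt` and `ord Δ_min` on the minimal model `X`
  haveI hXell : X.IsElliptic := by rw [hX, WeierstrassCurve.baseChange]; infer_instance
  have hrel : X = ((CA * C).map (algebraMap ℚ (v.adicCompletion ℚ))) •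
      W.baseChange (v.adicCompletion ℚ) := by
    rw [hX, hM, WeierstrassCurve.baseChange, WeierstrassCurve.baseChange, map_variableChange]
  refine ⟨?_, ?_⟩
  · rw [W.kodairaSymbolAt_eq_kodairaSymbolOfMinimal_of_isMinimal v X _ hrel X.isUnit_Δ.ne_zero, hK,
      show ν + 9 - 1 = ν + 8 by omega]
  · rw [W.ordMinimalDiscriminant_eq_of_isMinimal v X _ hrel X.isUnit_Δ.ne_zero, hordΔ]


end CaseA

/-! ### `d ≡ 1 (mod 4)`: multiplicative reduction -/

section CaseOne

variable (v : HeightOneSpectrum (𝓞 ℚ))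

/-- **`E ≅ T^{(d)}` with `d ≡ 1 (mod 4)` has multiplicative reduction at `2`**: the model
`y² + xy = x³ + ((d-1)/4)x² + d²a₄x + d³a₆` (`= (1; 0, ½, 0) • T^{(d)}`) is `2`-integral with
`c₄ = d²c₄(T)` a unit and `|Δ| = |d⁶Δ(T)| < 1` (Silverman *AEC* VII.5.1(b)); twisting by the
character of `ℚ(√d)`, unramified at `2`, does not change the reduction type.
[cite: SilvermanAEC2009, VII.5 Prop. 5.1(b) and X.5 Cor. 5.4.1] -/
theorem hasMultiplicativeReductionAt_of_emod_four_eq_one (hv : natGenerator v = 2)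
    (W : WeierstrassCurve ℚ) [W.IsElliptic] (hj : 1 < v.valuation ℚ W.j) {d : ℤ} (hd : d % 4 = 1)
    {C : VariableChange ℚ} (hC : C • W = (tateFormOfJ W.j).quadraticTwist (d : ℚ)) :
    W.HasMultiplicativeReductionAt v := by
  obtain ⟨hj0, hj1728, -⟩ := W.j_ne_and_valuation_j_sub_eq_of_one_lt_valuation_j v hj
  obtain ⟨ν, -, hν⟩ := exists_valuation_j_eq_exp v W hj
  obtain ⟨ha₄, ha₆, hΔT, -⟩ := valuation_tateFormOfJ_of_natGenerator_eq_two v W hv hj hν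
  obtain ⟨hc₄T, hΔT1⟩ := W.valuation_c₄_tateFormOfJ_eq_one_and_valuation_Δ_lt_one v hj
  have hvd : v.valuation ℚ (d : ℚ) = 1 :=
    Rat.valuation_intCast_eq_one v (by rw [hv]; exact_mod_cast (show ¬ (2 : ℤ) ∣ d by omega))
  set T := tateFormOfJ W.j with hT
  set C₁ : VariableChange ℚ := ⟨1, 0, 2⁻¹, 0⟩ with hC₁
  set M : WeierstrassCurve ℚ := (C₁ * C) • W with hM
  have hM' : M = ⟨1, ((d : ℚ) - 1) / 4, 0, (d : ℚ) ^ 2 * T.a₄, (d : ℚ) ^ 3 * T.a₆⟩ := by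
    rw [hM, mul_smul, hC]; exact smul_quadraticTwist_tateFormOfJ_eq_modelOne W.j d
  haveI : M.IsElliptic := by rw [hM]; infer_instance
  have hexp1 : ∀ k : ℕ, WithZero.exp (-(k : ℤ)) ≤ (1 : WithZero (Multiplicative ℤ)) := fun k ↦ by
    rw [← WithZero.exp_zero, WithZero.exp_le_exp]; omega
  obtain ⟨q, hq⟩ : ∃ q : ℤ, d - 1 = 4 * q := ⟨(d - 1) / 4, by omega⟩
  have hint : M.IsIntegralAt v := by
    refine M.isIntegralAt_of_valuation_le_one v ?_ ?_ ?_ ?_ ?_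
    · rw [hM', map_one]
    · have e : ((d : ℚ) - 1) / 4 = algebraMap (𝓞 ℚ) ℚ (q : 𝓞 ℚ) := by
        have : ((d : ℚ) - 1) = 4 * q := by exact_mod_cast hq
        rw [this]; simp
      rw [hM', e]; exact v.valuation_le_one _
    · rw [hM', map_zero]; exact zero_le_one
    · rw [hM', map_mul, map_pow, hvd, one_pow, one_mul, ha₄]; exact hexp1 _
    · rw [hM', map_mul, map_pow, hvd, one_pow, one_mul, ha₆]; exact hexp1 _
  have hc₄ : v.valuation ℚ M.c₄ = 1 := by
    rw [hM, mul_smul, hC, variableChange_c₄, quadraticTwist_c₄, hC₁]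
    simp only [inv_one, Units.val_one, one_pow, one_mul, map_mul, map_pow, hvd, hc₄T]
  have hΔ : v.valuation ℚ M.Δ < 1 := by
    rw [hM, mul_smul, hC, variableChange_Δ, quadraticTwist_Δ, hC₁]
    simp only [inv_one, Units.val_one, one_pow, one_mul, map_mul, map_pow, hvd]
    exact hΔT1
  have hmult := hasMultiplicativeReductionAt_of_valuation_c₄_eq_one hint hc₄ hΔ
  rw [hM] at hmult
  exact (hasMultiplicativeReductionAt_smul_iff_holds v W (C₁ * C)).mp hmult

end CaseOne

/-! ### Conductor exponents; normalising `d` -/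

section Conductor

variable (v : HeightOneSpectrum (𝓞 ℚ))

/-- **`f₂ = 4`, `δ₂ = 2` for `E ≅ T^{(d)}`, `d ≡ 3 (mod 4)`, `ord₂(j) < 0`**: Ogg's formula
`f = ord Δ_min + 1 - m` with `ord Δ_min = ν + 12`, `m = (ν + 4) + 5` (type `I*_{ν+4}`), and
`δ = f - 2`.  Silverman *ATAEC* IV.11.1 with Table 4.1.
[cite: SilvermanATAEC1994, IV.11.1 (Ogg's formula) and Table 4.1] -/
theorem conductorExponent_eq_four_of_emod_four_eq_three
    [PerfectField (IsLocalRing.ResidueField (v.adicCompletionIntegers ℚ))]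
    (hv : natGenerator v = 2) (W : WeierstrassCurve ℚ) [W.IsElliptic]
    (hj : 1 < v.valuation ℚ W.j) {d : ℤ} (hd : d % 4 = 3) {C : VariableChange ℚ}
    (hC : C • W = (tateFormOfJ W.j).quadraticTwist (d : ℚ)) :
    W.conductorExponent v = 4 ∧ W.wildConductorExponent v = 2 := by
  obtain ⟨ν, -, hν⟩ := exists_valuation_j_eq_exp v W hj
  obtain ⟨hK, hΔ⟩ :=
    kodairaSymbolAt_and_ordMinimalDiscriminant_of_emod_four_eq_three v hv W hj hν hd hC
  have hf : W.conductorExponent v = 4 := by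
    unfold conductorExponent numComponentsAt
    rw [hΔ, hK, KodairaSymbol.numComponents_Istar]; omega
  refine ⟨hf, ?_⟩
  unfold wildConductorExponent
  rw [hf, hK, KodairaSymbol.tameConductorExponent_Istar]

/-- **`f₂ = 6`, `δ₂ = 4` for `E ≅ T^{(d)}`, `d ≡ 2 (mod 4)`, `ord₂(j) < 0`**: `ord Δ_min = ν + 18`,
`m = (ν + 8) + 5` (type `I*_{ν+8}`).  Silverman *ATAEC* IV.11.1 with Table 4.1.
[cite: SilvermanATAEC1994, IV.11.1 (Ogg's formula) and Table 4.1] -/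
theorem conductorExponent_eq_six_of_emod_four_eq_two
    [PerfectField (IsLocalRing.ResidueField (v.adicCompletionIntegers ℚ))]
    (hv : natGenerator v = 2) (W : WeierstrassCurve ℚ) [W.IsElliptic]
    (hj : 1 < v.valuation ℚ W.j) {d : ℤ} (hd : d % 4 = 2) {C : VariableChange ℚ}
    (hC : C • W = (tateFormOfJ W.j).quadraticTwist (d : ℚ)) :
    W.conductorExponent v = 6 ∧ W.wildConductorExponent v = 4 := by
  obtain ⟨ν, -, hν⟩ := exists_valuation_j_eq_exp v W hj
  obtain ⟨hK, hΔ⟩ :=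
    kodairaSymbolAt_and_ordMinimalDiscriminant_of_emod_four_eq_two v hv W hj hν hd hC
  have hf : W.conductorExponent v = 6 := by
    unfold conductorExponent numComponentsAt
    rw [hΔ, hK, KodairaSymbol.numComponents_Istar]; omega
  refine ⟨hf, ?_⟩
  unfold wildConductorExponent
  rw [hf, hK, KodairaSymbol.tameConductorExponent_Istar]

/-- **Normalising the twist parameter.**  If `E` is a quadratic twist of `T = tateFormOfJ j(E)`
over `ℚ` (as it is whenever `j ≠ 0, 1728`), then `C • E = T^{(d)}` for some *integer* `d ≠ 0`
with `4 ∤ d` and some change of variables `C` over `ℚ`: twisting by `d` and by `de²` give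
`ℚ`-isomorphic curves (`exists_variableChange_quadraticTwist_mul_sq`), so the rational twist
parameter may be multiplied by the square of its denominator and divided by a power of `4`.
Silverman *AEC* X.5 Cor. 5.4.1. [cite: SilvermanAEC2009, X.5 Cor. 5.4.1] -/
theorem exists_int_variableChange_eq_quadraticTwist_tateFormOfJ (W : WeierstrassCurve ℚ)
    [W.IsElliptic] (hj0 : W.j ≠ 0) (hj1728 : W.j ≠ 1728) :
    ∃ d : ℤ, d ≠ 0 ∧ ¬ (4 : ℤ) ∣ d ∧
      ∃ C : VariableChange ℚ, C • W = (tateFormOfJ W.j).quadraticTwist (d : ℚ) := by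
  haveI := isElliptic_tateFormOfJ hj0 hj1728
  -- a rational twist parameter
  have hjT : W.j = (tateFormOfJ W.j).j := (tateFormOfJ_j hj0 hj1728).symm
  obtain ⟨r, hr0, C, hC⟩ := exists_variableChange_eq_quadraticTwist_of_j_eq' hjT hj0 hj1728
  -- clear the denominator: `r ↦ r · den²  = num · den`
  set n : ℤ := r.num * r.den with hn
  have hn0 : n ≠ 0 := mul_ne_zero (Rat.num_ne_zero.mpr hr0) (by exact_mod_cast r.den_nz)
  have hrn : r * (r.den : ℚ) ^ 2 = (n : ℚ) := by
    rw [hn, Int.cast_mul, Int.cast_natCast, sq, ← mul_assoc, Rat.mul_den_eq_num]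
  obtain ⟨C₁, hC₁⟩ := (tateFormOfJ W.j).exists_variableChange_quadraticTwist_mul_sq r (r.den : ℚ)
    (by exact_mod_cast r.den_nz)
  -- strip the powers of `4`
  obtain ⟨e, m, hm4, hnm⟩ := Nat.exists_eq_pow_mul_and_not_dvd (Int.natAbs_ne_zero.mpr hn0) 4
    (by norm_num)
  have hm0 : m ≠ 0 := by
    rintro rfl; rw [mul_zero] at hnm; exact (Int.natAbs_ne_zero.mpr hn0) hnm
  -- `d = sign(n) · m`, `n = d · (2^e)²`
  set d : ℤ := n.sign * m with hd
  have hnd : n = d * (2 ^ e) ^ 2 := by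
    have h1 : (n.natAbs : ℤ) = 4 ^ e * m := by exact_mod_cast hnm
    have h4 : (4 : ℤ) ^ e = (2 ^ e) ^ 2 := by
      rw [← pow_mul, show (4 : ℤ) = 2 ^ 2 by norm_num, ← pow_mul, mul_comm]
    calc n = n.sign * (n.natAbs : ℤ) := (Int.sign_mul_natAbs n).symm
      _ = d * (2 ^ e) ^ 2 := by rw [h1, hd, ← h4]; ring
  have hd0 : d ≠ 0 := by
    rw [hd]
    exact mul_ne_zero (fun h => hn0 (Int.sign_eq_zero_iff_zero.mp h)) (by exact_mod_cast hm0)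
  have hd4 : ¬ (4 : ℤ) ∣ d := by
    rw [hd]
    intro h
    apply hm4
    have h' := Int.natAbs_dvd_natAbs.mpr h
    rwa [Int.natAbs_mul, Int.natAbs_sign_of_ne_zero hn0, one_mul, Int.natAbs_natCast] at h'
  obtain ⟨C₂, hC₂⟩ := (tateFormOfJ W.j).exists_variableChange_quadraticTwist_mul_sq (d : ℚ)
    ((2 : ℚ) ^ e) (pow_ne_zero _ two_ne_zero)
  refine ⟨d, hd0, hd4, C₂⁻¹ * C₁ * C, ?_⟩
  rw [mul_smul, mul_smul, hC, hC₁, hrn, show (n : ℚ) = (d : ℚ) * ((2 : ℚ) ^ e) ^ 2 by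
    exact_mod_cast hnd, ← hC₂, inv_smul_smul]

/-- **`kodairaSymbolAt` is an isomorphism invariant** of an elliptic `W / K` at a place with
perfect residue field of the completion (from `kodairaSymbol_smul_holds`).  Silverman *ATAEC*
IV.9.4 (Tate's algorithm computes an invariant of `E/K_v`). [cite: SilvermanATAEC1994, IV.9.4] -/
theorem kodairaSymbolAt_smul' {A : Type*} [CommRing A] [IsDedekindDomain A] {K : Type*} [Field K]
    [Algebra A K] [IsFractionRing A K] (v : HeightOneSpectrum A) (W : WeierstrassCurve K)
    [PerfectField (IsLocalRing.ResidueField (v.adicCompletionIntegers K))] [W.IsElliptic]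
    (C : VariableChange K) : (C • W).kodairaSymbolAt v = W.kodairaSymbolAt v := by
  have hK := kodairaSymbol_smul_holds (v.adicCompletionIntegers K) (K := v.adicCompletion K)
  simp only [kodairaSymbolAt, WeierstrassCurve.baseChange, ← map_variableChange, hK]

/-- **The wild exponent `δ_v` is an isomorphism invariant** of an elliptic `W / K` (perfect residue
field), as are `f_v` (`conductorExponent_smul'`) and the Kodaira symbol. [cite: SilvermanATAEC1994, IV.10 (the conductor is an invariant of E)] -/
theorem wildConductorExponent_smul' {A : Type*} [CommRing A] [IsDedekindDomain A] {K : Type*}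
    [Field K] [Algebra A K] [IsFractionRing A K] (v : HeightOneSpectrum A) (W : WeierstrassCurve K)
    [PerfectField (IsLocalRing.ResidueField (v.adicCompletionIntegers K))] [W.IsElliptic]
    (C : VariableChange K) : (C • W).wildConductorExponent v = W.wildConductorExponent v := by
  unfold wildConductorExponent
  rw [conductorExponent_smul' v W C, kodairaSymbolAt_smul' v W C]

/-- **The wild exponent at `2` of an elliptic curve over `ℚ` with `ord₂(j) < 0`: `δ₂ ∈ {2, 4}` at
an additive place.**  For `W / ℚ` elliptic with additive reduction at the place `v` above `2` and
`ord₂(j) < 0`, there are `d ∈ ℤ` and `C` with `C • W = T^{(d)}`, `T = tateFormOfJ j`, and either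
`d ≡ 3 (mod 4)` and `δ_v = 2`, or `d ≡ 2 (mod 4)` and `δ_v = 4` (`d ≡ 1 (mod 4)` being excluded
by additivity, `d ≡ 0 (mod 4)` by the normalisation).  Silverman *ATAEC* IV.11.1, Table 4.1.
[cite: SilvermanATAEC1994, IV.11.1 (Ogg's formula) and Table 4.1] -/
theorem exists_twist_wildConductorExponent_of_hasAdditiveReductionAt
    [PerfectField (IsLocalRing.ResidueField (v.adicCompletionIntegers ℚ))]
    (hv : natGenerator v = 2) (W : WeierstrassCurve ℚ) [W.IsElliptic]
    (hj : 1 < v.valuation ℚ W.j) (hadd : W.HasAdditiveReductionAt v) :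
    ∃ d : ℤ, d ≠ 0 ∧ (∃ C : VariableChange ℚ, C • W = (tateFormOfJ W.j).quadraticTwist (d : ℚ)) ∧
      ((d % 4 = 3 ∧ W.wildConductorExponent v = 2) ∨ (d % 4 = 2 ∧ W.wildConductorExponent v = 4)) := by
  obtain ⟨hj0, hj1728, -⟩ := W.j_ne_and_valuation_j_sub_eq_of_one_lt_valuation_j v hj
  obtain ⟨d, hd0, hd4, C, hC⟩ := W.exists_int_variableChange_eq_quadraticTwist_tateFormOfJ hj0 hj1728
  refine ⟨d, hd0, ⟨C, hC⟩, ?_⟩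
  have hcases : d % 4 = 1 ∨ d % 4 = 2 ∨ d % 4 = 3 := by omega
  rcases hcases with h1 | h2 | h3
  · exact absurd (hasMultiplicativeReductionAt_of_emod_four_eq_one v hv W hj h1 hC)
      (hadd.not_hasMultiplicativeReductionAt)
  · exact Or.inr ⟨h2, (conductorExponent_eq_six_of_emod_four_eq_two v hv W hj h2 hC).2⟩
  · exact Or.inl ⟨h3, (conductorExponent_eq_four_of_emod_four_eq_three v hv W hj h3 hC).2⟩

end Conductor

end WeierstrassCurve

end
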